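import Summits.BirchSwinnertonDyer.Rank1Residual.X2.GreenbergVatsalStrictSelmer
import Summits.BirchSwinnertonDyer.Rank1Residual.X2.GreenbergVatsalTateKummer
import HarnessLib

/-!
# `Sel_{p^∞}(E/ℚ_∞)` at an odd prime `p ‖ N`, UNCONDITIONALLY on any local named fact: it is the
# non-primitive STRICT Greenberg group of the Tate datum (`⊓` Kummer at `Σ₀`); at a non-split `p`
# this is GV's `S^{Σ₀}_{E[p^∞]}(ℚ_∞)` itself (`e_p = 0`), at a split `p` it sits in `S^{Σ₀}` with
# the trivial-zero quotient embedded in `ℚ_p/ℤ_p` (`e_p ≤ 1`)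

HONEST FRAMING (cell `b2b-bsdres`, run/shared/lean/b2b/bsd-rank1-residual/, verbatim in every
file): the goal of the cell is to DELETE the COMBINATION-SHAPED residual classes of the
Birch–Swinnerton-Dyer formula for ALL analytic-rank `≤ 1` elliptic curves over `ℚ` — "full BSD
formula for every rank `≤ 1` curve in class `C`" assembled STRICTLY from published theorems — so
that the rank-`≤ 1` remainder becomes exactly the CONSTRUCTION-SHAPED classes, which are TYPED
(missing-input `Prop`s), NOT attempted. This is not "finishing BSD". Sub-cell
`b2b-bsdres-eisenstein-p2` (CLASS-OWNERS row "X2"), gen 12: research route; NO CLAIM BEYOND STATED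
CLASSES; nothing here changes a label. THEOREMS ONLY; CONDITIONAL only on the tree's named facts
`Silverman1994_thmV53_tateUniformisation` / `Silverman1994_thmV53_corV54_tateUniformisation`
(Silverman *ATAEC* V.3.1/V.5.2–5.4, PUBLISHED; hypotheses `hT`) — the Tate uniformisation itself.

WHY (X2-GAP §16.6, the `p ‖ N` member of a route-G pair; synthesis of gen 12). The cell's kernel
identification of the classical Selmer group over `ℚ_∞` with a Greenberg–Vatsal group needed ONE
printed local statement at `p`: at a good ordinary `p` the fact A111 (GV p. 26 / Greenberg Props.
2.2–2.4); at `p ‖ N` its twin, Greenberg LNM 1716 p. 76 `Im(κ_K) = Im(λ_K)`, typed this gen as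
`Greenberg1999.imKummer_ge_strictCondition_multiplicative` AND PROVED
(`GreenbergVatsalTateKummer.imKummer_ge_strictCondition_multiplicative_holds`: Tate parametrisation
+ continuous Hilbert 90). So at `p ‖ N` NO local named fact remains:
* **`exists_data_selmerInfty_eq_of_not_split`** — odd NON-SPLIT `p ‖ N`: Tate data `L` (GV's
  `htriv`) with `Sel_{p^∞}(E/ℚ_∞) = S^{Σ₀}_{E[p^∞]}(ℚ_∞) ⊓ (Kummer at Σ₀)` AND
  `S^{Σ₀,str} = S^{Σ₀}` — literally gen 10's good-ordinary identity, `e_p = 0`;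
* **`exists_data_selmerInfty_eq_of_split`** — SPLIT `p ‖ N` (`p` odd): Tate data `L` with `D_v`
  acting trivially on each `D`, `Sel_{p^∞}(E/ℚ_∞) = S^{Σ₀,str}_{E[p^∞]}(ℚ_∞) ⊓ (Kummer at Σ₀)`,
  `S^{Σ₀,str} ≤ S^{Σ₀}`, and at each `v ∣ p` an additive `e : greenbergKer → D ≅ ℚ_p/ℤ_p` with
  `e c = 0 ↔ c ∈ strictKer` (the trivial zero, `e_p ≤ 1`; `= 1` is GV Prop. (2.1), printed).
What stays PRINTED for route G at `p ‖ N` after gen 12: the Tate uniformisation (A40/A41), GV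
Cor. (2.3)/Prop. (2.4)/(2.5) for the Tate datum (`λ(S^{Σ₀}_A) = λ(S_A) + Σδ`, divisibility), GV
Prop. (2.1)'s surjectivity (`e_p = 1` exactly at split `p`), Kato–Rohrlich cotorsion.

References: Greenberg–Vatsal 2000 §2 pp. 14–17, 19–20, 26; Greenberg, LNM 1716 (1999) §2
pp. 69–76; Silverman *ATAEC* V.3.1, V.5.2–5.4.
-/

noncomputable section

open scoped Classical

namespace Summit.BirchSwinnertonDyer.Rank1Residual.X2.GreenbergVatsalStrictSelmerMultiplicative

open NumberField IsDedekindDomain Field Literature.NumberTheory.GaloisRepresentations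
  Literature.NumberTheory.EllipticCurves Literature.NumberTheory.EllipticCurves.GreenbergSelmer
  IsDedekindDomain.HeightOneSpectrum
  Summit.BirchSwinnertonDyer.Rank1Residual.X2.GreenbergVatsalTorsion
  Summit.BirchSwinnertonDyer.Rank1Residual.X2.GreenbergVatsalTateDatum
  Summit.BirchSwinnertonDyer.Rank1Residual.X2.GreenbergVatsalTateDatumSign
  Summit.BirchSwinnertonDyer.Rank1Residual.X2.GreenbergVatsalStrictSelmer
  Summit.BirchSwinnertonDyer.Rank1Residual.X2.GreenbergVatsalTateKummer

variable (W : WeierstrassCurve ℚ) [W.IsGloballyMinimal] [W.IsElliptic] (p : ℕ) [hp : Fact p.Prime]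
  (κ : ZpExtension ℚ p) (S₀ : Set (HeightOneSpectrum (𝓞 ℚ)))

omit [W.IsGloballyMinimal] in
/-- `HasMultiplicativeReductionAtPrime p` gives multiplicative reduction at the place `v ∋ p`.
[cite: SilvermanAEC2009, VII.5 Prop. 5.1(b)] -/
theorem hasMultiplicativeReductionAt_of_mem {v : HeightOneSpectrum (𝓞 ℚ)}
    (hmult : W.HasMultiplicativeReductionAtPrime p) (hpv : ((p : ℕ) : 𝓞 ℚ) ∈ v.asIdeal) :
    W.HasMultiplicativeReductionAt v := by
  have hvp : (Rat.HeightOneSpectrum.primesEquiv v : ℕ) = p :=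
    Rat.HeightOneSpectrum.primesEquiv_eq_of_natCast_mem v hp.out hpv
  have h := W.hasMultiplicativeReductionAtPrime_iff_hasMultiplicativeReductionAt_ringOfIntegers v
  subst hvp
  exact h.mp hmult

omit [W.IsGloballyMinimal] in
/-- `HasSplitMultiplicativeReductionAtPrime p` gives split multiplicative reduction at `v ∋ p`.
[cite: SilvermanAEC2009, VII.5 Prop. 5.1(b)] -/
theorem hasSplitMultiplicativeReductionAt_of_mem {v : HeightOneSpectrum (𝓞 ℚ)}
    (hsplit : W.HasSplitMultiplicativeReductionAtPrime p) (hpv : ((p : ℕ) : 𝓞 ℚ) ∈ v.asIdeal) :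
    W.HasSplitMultiplicativeReductionAt v := by
  have hvp : (Rat.HeightOneSpectrum.primesEquiv v : ℕ) = p :=
    Rat.HeightOneSpectrum.primesEquiv_eq_of_natCast_mem v hp.out hpv
  have h := W.hasSplitMultiplicativeReductionAtPrime_iff_hasSplitMultiplicativeReductionAt v
  subst hvp
  exact h.mp hsplit

/-- **At an odd NON-SPLIT `p ‖ N`: `Sel_{p^∞}(E/ℚ_∞) = S^{Σ₀}_{E[p^∞]}(ℚ_∞) ⊓ (Kummer at Σ₀)`
for Tate data, with NO local named fact** (`E/ℚ` globally minimal, `κ` cyclotomic, `Σ₀` such that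
every `v ∉ Σ₀ ∪ {p}` is good; granted only the PUBLISHED twisted Tate uniformisation `hT`). The data
satisfy GV's "`I_p` trivial on `D`" and `S^{Σ₀,str} = S^{Σ₀}` (`greenbergKer = strictKer`, gen 12
`GreenbergVatsalStrictAtNonsplit`); `hle` from gen 9's Kummer compatibility, `hge` = Greenberg
p. 76 PROVED (`imKummer_ge_strictCondition_multiplicative_holds`). This is gen 10's good-ordinary
identity verbatim at a non-split multiplicative prime: `e_p = 0`.
[cite: GreenbergVatsal2000, §2 pp. 14–17, 19] [cite: GreenbergLNM1716, §2 pp. 73–76]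
[cite: SilvermanATAEC1994, Ch. V Lemma 5.2 (c), Thm. 5.3 (a),(b), Cor. 5.4 (held copy PDF pp. 406–410)] -/
theorem exists_data_selmerInfty_eq_of_not_split
    (hT : Silverman1994_thmV53_corV54_tateUniformisation.{0}) (hκ : κ.IsCyclotomic) (hp2 : p ≠ 2)
    (hmult : W.HasMultiplicativeReductionAtPrime p) (hns : ¬ W.HasSplitMultiplicativeReductionAtPrime p)
    (hS : ∀ v : HeightOneSpectrum (𝓞 ℚ), v ∉ S₀ → ((p : ℕ) : 𝓞 ℚ) ∉ v.asIdeal →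
      W.HasGoodReductionAt v) :
    ∃ L : Data ℚ (W.geomPrimaryTorsion p) p,
      (∀ (v : HeightOneSpectrum (𝓞 ℚ)) (hv : ((p : ℕ) : 𝓞 ℚ) ∈ v.asIdeal),
        ∀ x ∈ inertia v, ∀ m : W.geomPrimaryTorsion p, x • m - m ∈ (L v hv).plus) ∧
      gvStrictSelmerInfty κ (W.geomPrimaryTorsion p) L S₀ =
        gvSelmerInfty κ (W.geomPrimaryTorsion p) L S₀ ∧
      W.selmerInfty κ =
        gvSelmerInfty κ (W.geomPrimaryTorsion p) L S₀ ⊓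
          ⨅ (v : HeightOneSpectrum (𝓞 ℚ)) (_ : v ∈ S₀) (σ : absoluteGaloisGroup ℚ),
            (W.localKerOver p κ.kerSubgroup (v.adicCompletion ℚ)).comap
              (conjH1 κ.kerSubgroup (W.geomPrimaryTorsion p) σ) := by
  -- at each `v ∣ p`: the Tate datum of the twisted parametrisation, with all four local facts
  have key : ∀ (v : HeightOneSpectrum (𝓞 ℚ)) (hv : ((p : ℕ) : 𝓞 ℚ) ∈ v.asIdeal),
      ∃ N : LocalDatum ℚ (W.geomPrimaryTorsion p) v,
        (∀ x ∈ inertia v, ∀ m : W.geomPrimaryTorsion p, x • m - m ∈ N.plus) ∧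
        N.greenbergKer κ.kerSubgroup = N.strictKer κ.kerSubgroup ∧
        W.localKerOver p κ.kerSubgroup (v.adicCompletion ℚ) ≤ N.strictKer κ.kerSubgroup ∧
        N.strictKer κ.kerSubgroup ≤ W.localKerOver p κ.kerSubgroup (v.adicCompletion ℚ) := by
    intro v hv
    obtain ⟨q, t, Ψ, hq0, hq1, -, ht2, hsurj, hker, hΨσ, -⟩ :=
      hT W v (hasMultiplicativeReductionAt_of_mem W p hmult hv)
    have hΨI : ∀ σ ∈ absInertia (v.adicCompletion ℚ),
        ∀ u : (AlgebraicClosure (v.adicCompletion ℚ))ˣ,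
        σ • Ψ (Additive.ofMul u) = Ψ (Additive.ofMul (Units.map
          (Field.absoluteGaloisGroup.toAlgEquiv (v.adicCompletion ℚ) σ :
            AlgebraicClosure (v.adicCompletion ℚ) →* AlgebraicClosure (v.adicCompletion ℚ)) u)) := by
      intro σ hσ u
      rw [hΨσ σ u, if_pos (GreenbergVatsalTateDatumRat.inertia_fix_sqrt_gamma W hp2 hmult hv t ht2 σ hσ),
        one_zsmul]
    have ht0 : t ≠ 0 := by
      -- `t = 0` would give `γ = -c₄/c₆ = 0`, but `c₄`, `c₆` are `p`-units at a multiplicative prime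
      intro h0
      rw [h0] at ht2
      have h4 : W.c₄ = ((WeierstrassCurve.integralModelInt W).c₄ : ℚ) := by
        conv_lhs => rw [← WeierstrassCurve.map_integralModelInt W]
        rw [WeierstrassCurve.map_c₄, eq_intCast]
      have h6 : W.c₆ = ((WeierstrassCurve.integralModelInt W).c₆ : ℚ) := by
        conv_lhs => rw [← WeierstrassCurve.map_integralModelInt W]
        rw [WeierstrassCurve.map_c₆, eq_intCast]
      obtain ⟨-, hc₄⟩ := Additive.dvd_and_not_dvd_c₄_of_hasMultiplicativeReductionAtPrime W p hmult
      have hc₆ := GreenbergVatsalTateDatumRat.not_dvd_c₆_of_hasMultiplicativeReductionAtPrime W hmult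
      have hγ0 : (-(W.c₄ / W.c₆) : ℚ) = 0 := by
        have h := ht2.symm
        rw [zero_pow two_ne_zero, ← IsScalarTower.algebraMap_apply, map_eq_zero_iff _
          (algebraMap ℚ (AlgebraicClosure (v.adicCompletion ℚ))).injective] at h
        exact h
      rw [h4, h6, neg_eq_zero, div_eq_zero_iff, Int.cast_eq_zero, Int.cast_eq_zero] at hγ0
      rcases hγ0 with h | h
      · exact hc₄ (by rw [h]; exact dvd_zero _)
      · exact hc₆ (by rw [h]; exact dvd_zero _)
    set N := tateDatum W p Ψ (sign_disj W Ψ t hΨσ) with hN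
    have heq : N.greenbergKer κ.kerSubgroup = N.strictKer κ.kerSubgroup :=
      GreenbergVatsalStrictAtNonsplit.greenbergKer_eq_strictKer_tate_of_flip W p κ Ψ t hΨσ hsurj
        (fun u h ↦ (hker u).1 h) ht0 ht2 hκ hp2 hmult hns hv
    refine ⟨N, tateDatum_htriv W p Ψ _ hsurj (fun u h ↦ (hker u).1 h) hΨI, heq, ?_, ?_⟩
    · exact (GreenbergVatsalSelmerLink.localKerOver_le_greenbergKer W p κ.kerSubgroup N
        (tateDatum_kummer W p Ψ _ hsurj (fun u h ↦ (hker u).1 h) hΨI hq0 hq1)).trans heq.le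
    · exact strictKer_le_localKerOver_tate W p Ψ t hq0 hq1 (fun u h ↦ (hker u).1 h) hΨσ N
        (mem_tateDatum_plus_iff _) κ.kerSubgroup hp2 (smul_sqrt_eq_or W t ht2)
  choose N hN₁ hN₂ hN₃ hN₄ using key
  have hstrict := gvStrictSelmerInfty_eq_gvSelmerInfty_of_forall_eq κ (W.geomPrimaryTorsion p) N S₀ hN₂
  refine ⟨N, hN₁, hstrict, ?_⟩
  rw [← hstrict]
  exact selmerInfty_eq_gvStrictSelmerInfty_inf W p κ N S₀ hp2 hκ hS hN₃ hN₄

omit [W.IsGloballyMinimal] in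
/-- **At a SPLIT `p ‖ N` (`p` odd): `Sel_{p^∞}(E/ℚ_∞) = S^{Σ₀,str}_{E[p^∞]}(ℚ_∞) ⊓ (Kummer at Σ₀)`
for the Tate data of the untwisted parametrisation, with NO local named fact**, `S^{Σ₀,str} ≤ S^{Σ₀}`,
`D_v` acting trivially on each `D`, and at each `v ∣ p` the trivial-zero embedding
`e : greenbergKer → D ≅ ℚ_p/ℤ_p`, `e c = 0 ↔ c ∈ strictKer` (gen 12 `GreenbergVatsalStrictAtSplit`).
`hle` = the all-`σ` Kummer compatibility (`tateDatum_kummer_all`), `hge` = Greenberg p. 76 PROVED.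
GV p. 15: "`Sel_E(ℚ_∞)_p` coincides with the 'strict' Selmer group … But `S_{E[p^∞]}(ℚ_∞)` is
actually bigger" — both halves now kernel statements (`e_p ≤ 1`; `= 1` is GV Prop. (2.1)).
[cite: GreenbergVatsal2000, §2 pp. 14–17, 19–20] [cite: GreenbergLNM1716, §2 pp. 75–76]
[cite: SilvermanATAEC1994, Ch. V Thm. 3.1 (c),(d) p. 423 and §V.5 Thm. 5.3 (a),(b)] -/
theorem exists_data_selmerInfty_eq_of_split
    (hT : Silverman1994_thmV53_tateUniformisation.{0}) (hκ : κ.IsCyclotomic) (hp2 : p ≠ 2)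
    (hsplit : W.HasSplitMultiplicativeReductionAtPrime p)
    (hS : ∀ v : HeightOneSpectrum (𝓞 ℚ), v ∉ S₀ → ((p : ℕ) : 𝓞 ℚ) ∉ v.asIdeal →
      W.HasGoodReductionAt v) :
    ∃ L : Data ℚ (W.geomPrimaryTorsion p) p,
      (∀ (v : HeightOneSpectrum (𝓞 ℚ)) (hv : ((p : ℕ) : 𝓞 ℚ) ∈ v.asIdeal),
        ∀ x ∈ inertia v, ∀ m : W.geomPrimaryTorsion p, x • m - m ∈ (L v hv).plus) ∧
      (∀ (v : HeightOneSpectrum (𝓞 ℚ)) (hv : ((p : ℕ) : 𝓞 ℚ) ∈ v.asIdeal),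
        ∀ (δ : decomp (K := ℚ) v) (d : (L v hv).Gr), δ • d = d) ∧
      W.selmerInfty κ =
        gvStrictSelmerInfty κ (W.geomPrimaryTorsion p) L S₀ ⊓
          ⨅ (v : HeightOneSpectrum (𝓞 ℚ)) (_ : v ∈ S₀) (σ : absoluteGaloisGroup ℚ),
            (W.localKerOver p κ.kerSubgroup (v.adicCompletion ℚ)).comap
              (conjH1 κ.kerSubgroup (W.geomPrimaryTorsion p) σ) ∧
      gvStrictSelmerInfty κ (W.geomPrimaryTorsion p) L S₀ ≤
        gvSelmerInfty κ (W.geomPrimaryTorsion p) L S₀ ∧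
      ∀ (v : HeightOneSpectrum (𝓞 ℚ)) (hv : ((p : ℕ) : 𝓞 ℚ) ∈ v.asIdeal),
        ∃ e : (L v hv).greenbergKer κ.kerSubgroup →+ (L v hv).Gr,
          ∀ c : (L v hv).greenbergKer κ.kerSubgroup,
            e c = 0 ↔ (c : W.subgroupH1 p κ.kerSubgroup) ∈ (L v hv).strictKer κ.kerSubgroup := by
  have key : ∀ (v : HeightOneSpectrum (𝓞 ℚ)) (hv : ((p : ℕ) : 𝓞 ℚ) ∈ v.asIdeal),
      ∃ N : LocalDatum ℚ (W.geomPrimaryTorsion p) v,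
        (∀ x ∈ inertia v, ∀ m : W.geomPrimaryTorsion p, x • m - m ∈ N.plus) ∧
        (∀ (δ : decomp (K := ℚ) v) (d : N.Gr), δ • d = d) ∧
        W.localKerOver p κ.kerSubgroup (v.adicCompletion ℚ) ≤ N.strictKer κ.kerSubgroup ∧
        N.strictKer κ.kerSubgroup ≤ W.localKerOver p κ.kerSubgroup (v.adicCompletion ℚ) ∧
        ∃ e : N.greenbergKer κ.kerSubgroup →+ N.Gr, ∀ c : N.greenbergKer κ.kerSubgroup,
          e c = 0 ↔ (c : W.subgroupH1 p κ.kerSubgroup) ∈ N.strictKer κ.kerSubgroup := by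
    intro v hv
    obtain ⟨q, Φ, hq0, hq1, hsurj, hker, hΦσ, -⟩ :=
      hT W v (hasSplitMultiplicativeReductionAt_of_mem W p hsplit hv)
    set N := tateDatum W p Φ (sign_disj W Φ 0 (sign_of_equivariant W Φ hΦσ)) with hN
    have htrivD : ∀ (δ : decomp (K := ℚ) v) (d : N.Gr), δ • d = d :=
      smul_gr_eq_of_equivariant W p Φ hΦσ hsurj (fun u h ↦ (hker u).1 h)
    refine ⟨N, tateDatum_htriv W p Φ _ hsurj (fun u h ↦ (hker u).1 h) (fun σ _ u ↦ hΦσ σ u),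
      htrivD, ?_, ?_, ?_⟩
    · exact localKerOver_le_strictKer_of_kummer_all W p κ.kerSubgroup N
        (tateDatum_kummer_all W p Φ hΦσ hsurj (fun u h ↦ (hker u).1 h) hq0 hq1)
    · exact strictKer_le_localKerOver_tate W p Φ 0 hq0 hq1 (fun u h ↦ (hker u).1 h)
        (sign_of_equivariant W Φ hΦσ) N (mem_tateDatum_plus_iff _) κ.kerSubgroup hp2
        (fun σ ↦ Or.inl (smul_zero σ))
    · exact GreenbergVatsalStrictAtSplit.exists_addMonoidHom_apply_eq_zero_iff_of_trivial W p κ N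
        htrivD hκ hv
  choose N hN₁ hN₂ hN₃ hN₄ hN₅ using key
  exact ⟨N, hN₁, hN₂, selmerInfty_eq_gvStrictSelmerInfty_inf W p κ N S₀ hp2 hκ hS hN₃ hN₄,
    gvStrictSelmerInfty_le_gvSelmerInfty κ _ N S₀, hN₅⟩

end Summit.BirchSwinnertonDyer.Rank1Residual.X2.GreenbergVatsalStrictSelmerMultiplicative

end
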